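import Summits.AtomisticToContinuum.HydrodynamicLimit.Theorems.OneFlightGossipEngineAssemblyEntropyProduction
import Summits.AtomisticToContinuum.HydrodynamicLimit.Theorems.TwoClocksClampedWindowDockEntropyProduction
import Summits.AtomisticToContinuum.HydrodynamicLimit.Theorems.JParityClosureKineticEnergyTailsApriori
import Literature.MathematicalPhysics.KineticTheory.HardSphereBBGKYLiouvilleFlow

/-!
# Crux `TwoClocks.ClampedEntropyClock` (stmt-AtomisticToContinuum-15145), line `IdeatorTwoSketch`, stub S7b-i: the relative entropy of the evolved law w.r.t. any local Gibbs reference is finite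

Yau's relative-entropy clock runs on the real numbers `H_N(s) = (KL(lawAt Φ λ_N s ‖ ψ_s)).toReal`
along a family of local Gibbs references `ψ_s`; converting back to `ℝ≥0∞` at the end of the
Gronwall argument needs these divergences to be FINITE. This file proves it, for the hard-sphere
system on `𝕋³` at reduced diameter `0 < σ ≤ 1/2` started from the local Gibbs law
`λ_N = localGibbsLaw σ a₀ u₀ θ₀ N Φ` and ANY local Gibbs reference `ψ = localGibbsLaw σ b w ϑ N Φ`
with continuous positive profiles, at every time `s` and every `N`:

1. TRANSPORT (`klDiv_lawAt_localGibbsLaw_eq`): `KL(lawAt Φ λ_N s ‖ ψ) = KL(λ_N ‖ (ρ_ψ ∘ Φ_s) dZ)`;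
2. `KL ≠ ∞ iff a.c. + integrable log-likelihood ratio` (`InformationTheory.klDiv_ne_top`):
   * `λ_N = ρ_λ dZ ≪ dZ ≪ (ρ_ψ ∘ Φ_s) dZ` since `ρ_ψ > 0` on the hard-sphere domain
     (`ae_canonicalDensity_localGibbsProfile_ne_zero`, pulled back by the Liouville-preserving `Φ_s`);
   * the log-likelihood ratio is `log ρ_λ − log ρ_ψ ∘ Φ_s` (`llr_withDensity_ae_eq`), which
     `λ_N`-a.s. is a ONE-BODY functional of the trajectory endpoints plus a c-number
     (`EntropyClockDock.ae_logRatio_eq_oneBody`): `Σ_i g₀(z_i) − Σ_i g((Φ_s z)_i) + const` with the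
     one-body exponent `g(x, v) = log b(x) − (3/2) log(2πϑ(x)) − |v − w(x)|²/(2ϑ(x))`;
   * `|g(x, v)| ≤ C (1 + |v|²)` on the compact torus (`abs_oneBody_le`), so both sums are dominated by
     `C (N+1) + C Σ_i |v_i|²` — at time `s` through CONSERVATION OF THE KINETIC ENERGY on the good set
     (`HardSphereFlow.configEnergy_flow`) — and `Σ_i |v_i|²` is `λ_N`-integrable: conditionally on the
     positions the velocities are independent Gaussians (`lintegral_meanVelObs_localGibbsMeasure_le`,
     `lintegral_norm_sq_gaussMeasure`).

Worker file for the registered stub `stub_klDivLawAtLocalGibbsNeTop` of the lead skeleton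
(`--supports stmt-AtomisticToContinuum-15145`). Imports: the tree's transport/production identities
(`OneFlightGossipEngineAssemblyEntropyTransport/Production`), part VI of the dock helpers
(`TwoClocksClampedWindowDockEntropyProduction`), the a-priori Gaussian velocity bounds of
`JParityClosureKineticEnergyTailsApriori` and the Literature flow file `HardSphereBBGKYLiouvilleFlow`
(none of them reaches a `Theses` module: their own imports are Literature / HarnessLib only).

References: H.-T. Yau, *Relative entropy and hydrodynamics of Ginzburg–Landau models*, Lett. Math. Phys.
22 (1991), §2; S. Olla, S. R. S. Varadhan, H.-T. Yau, *Hydrodynamical limit for a Hamiltonian system with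
weak noise*, Comm. Math. Phys. 155 (1993), §3; H. Spohn, *Large Scale Dynamics of Interacting Particles*
(1991), Part I §2.3 (local equilibrium states, Gaussian velocity marginals).
-/

noncomputable section

namespace Summit.AtomisticToContinuum.HydrodynamicLimit.Theorems.QuenchedCellClock

open MeasureTheory Set Filter Topology InformationTheory
open scoped ENNReal
open Literature.MathematicalPhysics.KineticTheory Literature.Analysis.FluidPDE
open Summit.AtomisticToContinuum.HydrodynamicLimit.Theorems.EntropyClockDock

/-! ### §1 The one-body exponent is dominated by the kinetic energy -/

/-- **One-body bound.** For continuous `b, ϑ > 0` and `w` on the (compact) torus, the one-body exponent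
`g(x, v) = log b(x) − (3/2) log(2πϑ(x)) − |v − w(x)|²/(2ϑ(x))` of a local Gibbs reference satisfies
`|g(x, v)| ≤ C (1 + |v|²)` (`|log b|, |log 2πϑ|, 1/ϑ, |w|` are bounded). [folklore] -/
theorem abs_oneBody_le {b ϑ : T3 → ℝ} {w : T3 → V3} (hb : Continuous b) (hϑ : Continuous ϑ)
    (hw : Continuous w) (hb0 : ∀ x, 0 < b x) (hϑ0 : ∀ x, 0 < ϑ x) :
    ∃ C : ℝ, 0 ≤ C ∧ ∀ (x : T3) (v : V3),
      |Real.log (b x) - 3 / 2 * Real.log (2 * Real.pi * ϑ x) - ‖v - w x‖ ^ 2 / (2 * ϑ x)| ≤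
        C * (1 + ‖v‖ ^ 2) := by
  obtain ⟨B₁, hB₁, h₁⟩ := exists_forall_abs_le_of_continuous (hb.log fun x => (hb0 x).ne')
  have hc₂ : Continuous fun x => Real.log (2 * Real.pi * ϑ x) :=
    (continuous_const.mul hϑ).log fun x => (mul_pos Real.two_pi_pos (hϑ0 x)).ne'
  obtain ⟨B₂, hB₂, h₂⟩ := exists_forall_abs_le_of_continuous hc₂
  have hc₃ : Continuous fun x => (ϑ x)⁻¹ := hϑ.inv₀ fun x => (hϑ0 x).ne'
  obtain ⟨B₃, hB₃, h₃⟩ := exists_forall_abs_le_of_continuous hc₃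
  obtain ⟨W, hW, h₄⟩ := exists_forall_abs_le_of_continuous hw.norm
  refine ⟨B₁ + 3 / 2 * B₂ + W ^ 2 * B₃ + B₃, by positivity, fun x v => ?_⟩
  have hϑx := hϑ0 x
  have hl₁ : -B₁ ≤ Real.log (b x) ∧ Real.log (b x) ≤ B₁ := abs_le.1 (h₁ x)
  have hl₂ : -B₂ ≤ Real.log (2 * Real.pi * ϑ x) ∧ Real.log (2 * Real.pi * ϑ x) ≤ B₂ :=
    abs_le.1 (h₂ x)
  have hi : (ϑ x)⁻¹ ≤ B₃ := (le_abs_self _).trans (h₃ x)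
  have hwx : ‖w x‖ ≤ W := (le_abs_self _).trans (by simpa only [abs_norm] using h₄ x)
  -- the quadratic term
  have hq0 : 0 ≤ ‖v - w x‖ ^ 2 / (2 * ϑ x) := by positivity
  have hsq : ‖v - w x‖ ^ 2 ≤ 2 * ‖v‖ ^ 2 + 2 * W ^ 2 := by
    have h := norm_sub_le v (w x)
    nlinarith [norm_nonneg v, norm_nonneg (w x), norm_nonneg (v - w x), sq_nonneg (‖v‖ - ‖w x‖)]
  have hq : ‖v - w x‖ ^ 2 / (2 * ϑ x) ≤ (‖v‖ ^ 2 + W ^ 2) * B₃ := by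
    rw [div_le_iff₀ (by positivity)]
    have h1 : (‖v‖ ^ 2 + W ^ 2) * 1 ≤ (‖v‖ ^ 2 + W ^ 2) * (B₃ * ϑ x) :=
      mul_le_mul_of_nonneg_left (by rwa [← div_le_iff₀ hϑx, one_div]) (by positivity)
    nlinarith
  have hv0 : 0 ≤ ‖v‖ ^ 2 := sq_nonneg _
  rw [abs_le]
  constructor
  · nlinarith [mul_nonneg hB₁ hv0, mul_nonneg hB₂ hv0, mul_nonneg (mul_nonneg (sq_nonneg W) hB₃) hv0]
  · nlinarith [mul_nonneg hB₁ hv0, mul_nonneg hB₂ hv0, mul_nonneg (mul_nonneg (sq_nonneg W) hB₃) hv0,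
      mul_nonneg hB₃ hv0]

/-- Summing the one-body bound over the particles: `|Σ_i g(z_i)| ≤ C n + C Σ_i |v_i|²`. [folklore] -/
theorem abs_sum_oneBody_le {b ϑ : T3 → ℝ} {w : T3 → V3} {C : ℝ}
    (hC : ∀ (x : T3) (v : V3),
      |Real.log (b x) - 3 / 2 * Real.log (2 * Real.pi * ϑ x) - ‖v - w x‖ ^ 2 / (2 * ϑ x)| ≤
        C * (1 + ‖v‖ ^ 2))
    {n : ℕ} (z : Config n (Fin 3) T3) :
    |∑ i, (Real.log (b (z i).1) - 3 / 2 * Real.log (2 * Real.pi * ϑ (z i).1) -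
        ‖(z i).2 - w (z i).1‖ ^ 2 / (2 * ϑ (z i).1))| ≤ C * n + C * ∑ i, ‖(z i).2‖ ^ 2 := by
  calc |∑ i, (Real.log (b (z i).1) - 3 / 2 * Real.log (2 * Real.pi * ϑ (z i).1) -
        ‖(z i).2 - w (z i).1‖ ^ 2 / (2 * ϑ (z i).1))|
      ≤ ∑ i, |Real.log (b (z i).1) - 3 / 2 * Real.log (2 * Real.pi * ϑ (z i).1) -
          ‖(z i).2 - w (z i).1‖ ^ 2 / (2 * ϑ (z i).1)| := Finset.abs_sum_le_sum_abs _ _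
    _ ≤ ∑ i, C * (1 + ‖(z i).2‖ ^ 2) := Finset.sum_le_sum fun i _ => hC _ _
    _ = C * n + C * ∑ i, ‖(z i).2‖ ^ 2 := by
        rw [← Finset.mul_sum, Finset.sum_add_distrib, Finset.sum_const, Finset.card_univ,
          Fintype.card_fin, nsmul_eq_mul, mul_one, mul_add]

/-- The one-body sum `z ↦ Σ_i g(z_i)` is measurable (continuous profiles). [folklore] -/
theorem measurable_sum_oneBody {b ϑ : T3 → ℝ} {w : T3 → V3} (hb : Continuous b) (hϑ : Continuous ϑ)
    (hw : Continuous w) (n : ℕ) :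
    Measurable fun z : Config n (Fin 3) T3 => ∑ i, (Real.log (b (z i).1) -
      3 / 2 * Real.log (2 * Real.pi * ϑ (z i).1) - ‖(z i).2 - w (z i).1‖ ^ 2 / (2 * ϑ (z i).1)) := by
  have hbm := hb.measurable
  have hϑm := hϑ.measurable
  have hwm := hw.measurable
  fun_prop

/-! ### §2 The kinetic energy is integrable under the local Gibbs law -/

-- adapted from `CollisionActivityTailsMeanEnergyBound.stub_meanEnergyBound`
-- (Theorems/OneFlightGossipEngineCollisionActivityTailsMeanEnergyBound.lean)
/-- **`Σ_i |v_i|²` is integrable under the local Gibbs law** (continuous profiles `a₀ ≥ 0`, `θ₀ > 0`,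
`u₀`; every `σ`, `N`, flow): conditionally on the positions the velocities are independent Gaussians
with second moment `|u₀(x)|² + 3θ₀(x) ≤ sup |u₀|² + 3 sup θ₀`
(`lintegral_meanVelObs_localGibbsMeasure_le`, `lintegral_norm_sq_gaussMeasure`). [folklore] -/
theorem integrable_sum_norm_sq_localGibbsLaw {σ : ℝ} {a₀ θ₀ : T3 → ℝ} {u₀ : T3 → V3}
    (ha : Continuous a₀) (hθ : Continuous θ₀) (hu : Continuous u₀) (ha0 : ∀ x, 0 ≤ a₀ x)
    (hθ0 : ∀ x, 0 < θ₀ x) (N : ℕ)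
    (Φ : HardSphereFlow (Torus.geometry (Fin 3)) (hsDiameter σ N) (N + 1)) :
    Integrable (fun z : Config (N + 1) (Fin 3) T3 => ∑ i, ‖(z i).2‖ ^ 2)
      (localGibbsLaw σ a₀ u₀ θ₀ N Φ) := by
  obtain ⟨Θ, -, hΘ⟩ := exists_forall_abs_le_of_continuous hθ
  obtain ⟨U, -, hU⟩ := exists_forall_abs_le_of_continuous hu.norm
  have hB : ∀ y : T3, ∫⁻ w, ENNReal.ofReal (‖w‖ ^ 2) ∂gaussMeasure (u₀ y) (θ₀ y) ≤
      ENNReal.ofReal (U ^ 2 + 3 * Θ) := by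
    intro y
    rw [lintegral_norm_sq_gaussMeasure (u₀ y) (hθ0 y)]
    refine ENNReal.ofReal_le_ofReal ?_
    have hUy : ‖u₀ y‖ ≤ U := (le_abs_self _).trans (by simpa only [abs_norm] using hU y)
    have hUy2 : ‖u₀ y‖ ^ 2 ≤ U ^ 2 := pow_le_pow_left₀ (norm_nonneg _) hUy 2
    linarith [(le_abs_self _).trans (hΘ y)]
  have hmean : ∫⁻ z, ENNReal.ofReal (((N : ℝ) + 1)⁻¹ * ∑ i, ‖(z i).2‖ ^ 2)
      ∂localGibbsMeasure σ a₀ u₀ θ₀ N ≤ ENNReal.ofReal (U ^ 2 + 3 * Θ) :=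
    lintegral_meanVelObs_localGibbsMeasure_le ha hθ hu ha0 hθ0 (f := fun v : V3 => ‖v‖ ^ 2)
      (by fun_prop) (fun v => sq_nonneg _) hB σ N
  have hm : Measurable fun z : Config (N + 1) (Fin 3) T3 => ∑ i, ‖(z i).2‖ ^ 2 := by fun_prop
  rw [localGibbsLaw_eq]
  refine ⟨hm.aestronglyMeasurable, (hasFiniteIntegral_iff_ofReal (Eventually.of_forall fun z =>
    Finset.sum_nonneg fun i _ => sq_nonneg _)).2 ?_⟩
  have hsplit : ∀ z : Config (N + 1) (Fin 3) T3, ENNReal.ofReal (∑ i, ‖(z i).2‖ ^ 2) =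
      ENNReal.ofReal ((N : ℝ) + 1) * ENNReal.ofReal (((N : ℝ) + 1)⁻¹ * ∑ i, ‖(z i).2‖ ^ 2) := by
    intro z
    rw [← ENNReal.ofReal_mul (by positivity), ← mul_assoc,
      mul_inv_cancel₀ (by positivity : ((N : ℝ) + 1) ≠ 0), one_mul]
  simp_rw [hsplit]
  rw [lintegral_const_mul' _ _ ENNReal.ofReal_ne_top]
  exact ENNReal.mul_lt_top ENNReal.ofReal_lt_top (hmean.trans_lt ENNReal.ofReal_lt_top)

/-! ### §3 The stub -/

/-- **Stub S7b-i — the relative entropy of the evolved law with respect to any local Gibbs reference is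
finite.** For the hard-sphere system on `𝕋³` at reduced diameter `0 < σ ≤ 1/2` started from the local
Gibbs law `λ_N = localGibbsLaw σ a₀ u₀ θ₀ N Φ` (continuous positive profiles) and any local Gibbs reference
`ψ = localGibbsLaw σ b w ϑ N Φ` with continuous positive profiles: `KL(lawAt Φ λ_N s ‖ ψ) ≠ ∞` for every
`N` and `s`. Transport along the flow (`klDiv_lawAt_localGibbsLaw_eq`), then `klDiv_ne_top`: absolute
continuity from the positivity of `ρ_ψ` on the hard-sphere domain, and integrability of the
log-likelihood ratio `log ρ_λ − log ρ_ψ ∘ Φ_s` — a one-body functional of the trajectory endpoints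
(`ae_logRatio_eq_oneBody`) dominated by `C (N+1) + C Σ_i |v_i|²` through conservation of the kinetic
energy (`HardSphereFlow.configEnergy_flow`), integrable by the Gaussian velocity marginal
(`integrable_sum_norm_sq_localGibbsLaw`). [cite: Yau1991, §2] -/
theorem stub_klDivLawAtLocalGibbsNeTop {σ : ℝ} (_hσ : 0 < σ) (hσ2 : σ ≤ 1 / 2)
    {a₀ θ₀ b ϑ : T3 → ℝ} {u₀ w : T3 → V3}
    (ha : Continuous a₀) (hθ : Continuous θ₀) (hu : Continuous u₀) (ha0 : ∀ x, 0 < a₀ x)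
    (hθ0 : ∀ x, 0 < θ₀ x) (hb : Continuous b) (hϑ : Continuous ϑ) (hw : Continuous w)
    (hb0 : ∀ x, 0 < b x) (hϑ0 : ∀ x, 0 < ϑ x)
    (N : ℕ) (Φ : HardSphereFlow (Torus.geometry (Fin 3)) (hsDiameter σ N) (N + 1)) (s : ℝ) :
    klDiv (Φ.lawAt (localGibbsLaw σ a₀ u₀ θ₀ N Φ) s) (localGibbsLaw σ b w ϑ N Φ) ≠ ⊤ := by
  haveI i₀ : IsProbabilityMeasure (localGibbsLaw σ a₀ u₀ θ₀ N Φ) :=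
    isProbabilityMeasure_localGibbsLaw ha hθ hu ha0 hθ0 hσ2 N Φ
  haveI i₁ : IsProbabilityMeasure (localGibbsLaw σ b w ϑ N Φ) :=
    isProbabilityMeasure_localGibbsLaw hb hϑ hw hb0 hϑ0 hσ2 N Φ
  -- σ-finiteness of the Liouville measure (instance path made explicit)
  haveI hXE : SigmaFinite (volume : Measure (T3 × V3)) := inferInstance
  haveI hC : SigmaFinite (volume : Measure (Config (N + 1) (Fin 3) T3)) := inferInstance
  haveI hL : SigmaFinite (liouville (Torus.geometry (Fin 3)) (N + 1) (hsDiameter σ N)) := by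
    rw [liouville_eq]; infer_instance
  -- step 1: transport along the flow
  rw [klDiv_lawAt_localGibbsLaw_eq N Φ hb hϑ hw s]
  -- the two densities w.r.t. the Liouville measure
  have hf : Measurable fun z => ENNReal.ofReal (canonicalDensity (Torus.geometry (Fin 3))
      (hsDiameter σ N) (N + 1) (localGibbsProfile a₀ u₀ θ₀) z) :=
    (measurable_canonicalDensity _ _ (measurable_localGibbsProfile ha hθ hu)).ennreal_ofReal
  have hg : Measurable fun z => ENNReal.ofReal (canonicalDensity (Torus.geometry (Fin 3))
      (hsDiameter σ N) (N + 1) (localGibbsProfile b w ϑ) (Φ.flow s z)) :=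
    ((measurable_canonicalDensity _ _ (measurable_localGibbsProfile hb hϑ hw)).comp
      (Φ.measurable_flow s)).ennreal_ofReal
  have hg0 : ∀ᵐ z ∂liouville (Torus.geometry (Fin 3)) (N + 1) (hsDiameter σ N),
      ENNReal.ofReal (canonicalDensity (Torus.geometry (Fin 3)) (hsDiameter σ N) (N + 1)
        (localGibbsProfile b w ϑ) (Φ.flow s z)) ≠ 0 :=
    (Φ.measurePreserving s).quasiMeasurePreserving.ae
      (ae_canonicalDensity_localGibbsProfile_ne_zero hb hϑ hw hb0 hϑ0 hσ2 N)
  have hdens : localGibbsLaw σ a₀ u₀ θ₀ N Φ =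
      (liouville (Torus.geometry (Fin 3)) (N + 1) (hsDiameter σ N)).withDensity fun z =>
        ENNReal.ofReal (canonicalDensity (Torus.geometry (Fin 3)) (hsDiameter σ N) (N + 1)
          (localGibbsProfile a₀ u₀ θ₀) z) := rfl
  have hacL : localGibbsLaw σ a₀ u₀ θ₀ N Φ ≪ liouville (Torus.geometry (Fin 3)) (N + 1) (hsDiameter σ N) := by
    rw [hdens]; exact withDensity_absolutelyContinuous _ _
  -- step 2a: absolute continuity
  have hac : localGibbsLaw σ a₀ u₀ θ₀ N Φ ≪
      (liouville (Torus.geometry (Fin 3)) (N + 1) (hsDiameter σ N)).withDensity fun z =>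
        ENNReal.ofReal (canonicalDensity (Torus.geometry (Fin 3)) (hsDiameter σ N) (N + 1)
          (localGibbsProfile b w ϑ) (Φ.flow s z)) :=
    hacL.trans (withDensity_absolutelyContinuous' hg.aemeasurable hg0)
  refine klDiv_ne_top hac ?_
  -- step 2b: integrability of the log-likelihood ratio, i.e. of `log ρ_λ − log ρ_ψ ∘ Φ_s` under `λ_N`
  obtain ⟨C₀, -, hC₀⟩ := abs_oneBody_le ha hθ hu ha0 hθ0
  obtain ⟨C, -, hC⟩ := abs_oneBody_le hb hϑ hw hb0 hϑ0
  have hE := integrable_sum_norm_sq_localGibbsLaw ha hθ hu (fun x => (ha0 x).le) hθ0 N Φ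
  have hgood : ∀ᵐ z ∂(localGibbsLaw σ a₀ u₀ θ₀ N Φ), z ∈ Φ.good := hacL.ae_le Φ.ae_mem_good
  -- the time-`0` one-body sum
  have hS₀ : Integrable (fun z : Config (N + 1) (Fin 3) T3 => ∑ i, (Real.log (a₀ (z i).1) -
      3 / 2 * Real.log (2 * Real.pi * θ₀ (z i).1) - ‖(z i).2 - u₀ (z i).1‖ ^ 2 / (2 * θ₀ (z i).1)))
      (localGibbsLaw σ a₀ u₀ θ₀ N Φ) := by
    have hdom : Integrable (fun z : Config (N + 1) (Fin 3) T3 =>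
        C₀ * ((N + 1 : ℕ) : ℝ) + C₀ * ∑ i, ‖(z i).2‖ ^ 2) (localGibbsLaw σ a₀ u₀ θ₀ N Φ) :=
      (integrable_const _).add (hE.const_mul C₀)
    refine hdom.mono' (measurable_sum_oneBody ha hθ hu (N + 1)).aestronglyMeasurable
      (Eventually.of_forall fun z => ?_)
    rw [Real.norm_eq_abs]
    exact abs_sum_oneBody_le hC₀ z
  -- the time-`s` one-body sum (conservation of the kinetic energy on the good set)
  have hS : Integrable (fun z : Config (N + 1) (Fin 3) T3 => ∑ i, (Real.log (b (Φ.flow s z i).1) -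
      3 / 2 * Real.log (2 * Real.pi * ϑ (Φ.flow s z i).1) -
      ‖(Φ.flow s z i).2 - w (Φ.flow s z i).1‖ ^ 2 / (2 * ϑ (Φ.flow s z i).1)))
      (localGibbsLaw σ a₀ u₀ θ₀ N Φ) := by
    have hdom : Integrable (fun z : Config (N + 1) (Fin 3) T3 =>
        C * ((N + 1 : ℕ) : ℝ) + C * ∑ i, ‖(z i).2‖ ^ 2) (localGibbsLaw σ a₀ u₀ θ₀ N Φ) :=
      (integrable_const _).add (hE.const_mul C)
    refine hdom.mono' ((measurable_sum_oneBody hb hϑ hw (N + 1)).comp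
      (Φ.measurable_flow s)).aestronglyMeasurable ?_
    filter_upwards [hgood] with z hz
    rw [Real.norm_eq_abs]
    have hen : ∑ i, ‖(Φ.flow s z i).2‖ ^ 2 = ∑ i, ‖(z i).2‖ ^ 2 := by
      have h := Φ.configEnergy_flow hz s
      simp only [configEnergy] at h
      linarith
    exact hen ▸ abs_sum_oneBody_le hC (Φ.flow s z)
  -- the explicit log-ratio is integrable
  have hkey : Integrable (fun z => Real.log (canonicalDensity (Torus.geometry (Fin 3)) (hsDiameter σ N)
      (N + 1) (localGibbsProfile a₀ u₀ θ₀) z) - Real.log (canonicalDensity (Torus.geometry (Fin 3))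
      (hsDiameter σ N) (N + 1) (localGibbsProfile b w ϑ) (Φ.flow s z))) (localGibbsLaw σ a₀ u₀ θ₀ N Φ) := by
    have hrhs : Integrable (fun z : Config (N + 1) (Fin 3) T3 =>
        ((∑ i, (Real.log (a₀ (z i).1) - 3 / 2 * Real.log (2 * Real.pi * θ₀ (z i).1) -
            ‖(z i).2 - u₀ (z i).1‖ ^ 2 / (2 * θ₀ (z i).1))) -
          ∑ i, (Real.log (b (Φ.flow s z i).1) - 3 / 2 * Real.log (2 * Real.pi * ϑ (Φ.flow s z i).1) -
            ‖(Φ.flow s z i).2 - w (Φ.flow s z i).1‖ ^ 2 / (2 * ϑ (Φ.flow s z i).1))) +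
        (Real.log (posPartition b (hsDiameter σ N) (N + 1)) -
          Real.log (posPartition a₀ (hsDiameter σ N) (N + 1)))) (localGibbsLaw σ a₀ u₀ θ₀ N Φ) :=
      (hS₀.sub hS).add (integrable_const _)
    refine hrhs.congr ?_
    filter_upwards [ae_logRatio_eq_oneBody hσ2 a₀ θ₀ u₀ ha hθ hu ha0 hθ0 hb hϑ hw hb0 hϑ0 N Φ s]
      with z hz
    exact hz.symm
  -- the log-likelihood ratio of the two densities is the explicit log-ratio, `λ_N`-a.s.
  have hllr := llr_withDensity_ae_eq (liouville (Torus.geometry (Fin 3)) (N + 1) (hsDiameter σ N)) hf hg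
    (Eventually.of_forall fun _ => ENNReal.ofReal_ne_top) hg0
    (Eventually.of_forall fun _ => ENNReal.ofReal_ne_top)
  rw [← hdens] at hllr
  refine (hkey.congr (Eventually.of_forall fun z => ?_)).congr hllr.symm
  simp only [ENNReal.toReal_ofReal (canonicalDensity_localGibbsProfile_nonneg (fun x => (ha0 x).le)
      (fun x => (hθ0 x).le) _ _ _),
    ENNReal.toReal_ofReal (canonicalDensity_localGibbsProfile_nonneg (fun x => (hb0 x).le)
      (fun x => (hϑ0 x).le) _ _ _)]

end Summit.AtomisticToContinuum.HydrodynamicLimit.Theorems.QuenchedCellClock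

end
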